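import Summits.PneNP.PneNP.Theorems.NegLimitedLadderFixedK
import Summits.PneNP.PneNP.Theorems.NegLimitedLadderRecurringCliqueSlices

/-!
# Route NegLimited — the rung `NeglimitedLogOverOmegaNegations` (line `density-ladder`, stub 6 + closer; rung F-N1/p3, ROUND-9 §B)

Registered stub `stub_omegaAssembly` of the skeleton `density-ladder`
(HOME/pnp-ideate-p3/r9/ladder/density-ladder.lean, sha 2d55ebf8) on the support item
`NegLimited.NeglimitedLogOverOmegaNegations` (stmt-PneNP-19555):
`NeglimitedCliqueFixedK → RecurringCliqueSlicesNP → NeglimitedLogOverOmegaNegations`, and the rung itself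
(`neglimitedLogOverOmegaNegations_holds`) from the landed engine `neglimitedCliqueFixedK_holds`
(`NegLimitedLadderFixedK.lean`, R9-A) and the landed slice plumbing `stub_recurringCliqueSlicesNP`
(`NegLimitedLadderRecurringCliqueSlices.lean`).

**The rung (R9-B).** ONE explicit `NP` language with monotone slices beats every polynomial against
De Morgan circuits with `⌊log₂ n⌋ / w(n)` NOT gates, for EVERY unbounded budget divisor `w`: strictly
between the closed rung stmt-PneNP-19657 (`w(n) = 40(⌊log₂⌊log₂ n⌋⌋ + 1)`) and the door stmt-PneNP-19860
(`w` bounded).  Print record for unbounded-depth circuits and an explicit monotone function: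
`(1/6) log log n` NOT gates [AmanoMaruoka2005; Rossman CCC 2015 p. 395; Jukna 2012 RP 9.29/10.23].

Proof of the stub (filters + `Nat.log` arithmetic): given `w → ∞` and `c`, take `k = 16c + 17`; beyond the
threshold `m₁` of `NeglimitedCliqueFixedK k` and the point `N` from which `w ≥ 8k⁴`, the recurrence of
`RecurringCliqueSlicesNP` gives `m ≥ max m₁ N n₀ 2` and a length `n ∈ [m, m⁴]` whose slice is monotone and
inherits lower bounds for `CLIQUE(m, k)`; the budget `⌊log₂ n⌋ / w(n) ≤ (4⌊log₂ m⌋ + 3)/(8k⁴) ≤ ⌊log₂ m⌋ / k⁴`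
(`Nat.log 2 (m⁴) ≤ 4 Nat.log 2 m + 3`), and every admissible `D` has
`size D + 1 > m^{k/4} ≥ m^{4c+4} ≥ 16 n^c ≥ n^c + 2`.

STATUS OF THE BY-NAME CLOSER: the route file `Theses/NegLimited.lean` does not yet declare
`NeglimitedLogOverOmegaNegations` (item added 2026-08-26T10:14Z, re-render pending); this file proves the
statement against the verbatim local copy; the one-line wrapper
`theorem … : Summit.PneNP.PneNP.Theses.NegLimited.NeglimitedLogOverOmegaNegations := neglimitedLogOverOmegaNegations_holds`
is filed as soon as the decl is rendered (same body, definitional).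
-/

set_option linter.dupNamespace false -- `Summit.PneNP.PneNP.…`: summit = sub-problem name (D-0017 single-conjunct layout)

namespace Summit.PneNP.PneNP.Theorems.NegLimitedLadder

open Finset Filter
open Literature.Computability.Complexity

/-- **RUNG `NeglimitedLogOverOmegaNegations` (R9-B)** (verbatim from the registered skeleton `density-ladder`
= the signature of item stmt-PneNP-19555): ONE explicit NP language with monotone slices beats every
polynomial against De Morgan circuits with `⌊log₂ n⌋ / w(n)` NOT gates, for EVERY unbounded budget divisor
`w`. -/
def NeglimitedLogOverOmegaNegations : Prop :=
  ∃ L ∈ Literature.Computability.Complexity.Nondeterministic.NP, ∀ w : ℕ → ℕ,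
    Tendsto w atTop atTop → ∀ c : ℕ, ∃ᶠ n : ℕ in atTop, Monotone (L.sliceFn n) ∧
      n ^ c < negLimitedSizeOver deMorganBasis (Nat.log 2 n / w n) (L.sliceFn n)

/-! ### `Nat.log` and budget arithmetic -/

/-- `⌊log₂ (m⁴)⌋ ≤ 4 ⌊log₂ m⌋ + 3`. -/
theorem omega_log_pow_four_le (m : ℕ) : Nat.log 2 (m ^ 4) ≤ 4 * Nat.log 2 m + 3 := by
  rcases Nat.eq_zero_or_pos m with rfl | hm
  · simp
  have hlt : m < 2 ^ (Nat.log 2 m + 1) := Nat.lt_pow_succ_log_self one_lt_two m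
  have h4 : m ^ 4 < 2 ^ (4 * Nat.log 2 m + 4) := by
    calc m ^ 4 < (2 ^ (Nat.log 2 m + 1)) ^ 4 := Nat.pow_lt_pow_left hlt (by norm_num)
      _ = 2 ^ (4 * Nat.log 2 m + 4) := by rw [← pow_mul]; ring_nf
  have h := (Nat.log_lt_iff_lt_pow one_lt_two (by positivity)).2 h4
  omega

/-- The NOT budget at length `n ≤ m⁴` with `w n ≥ 8k⁴` (`m ≥ 2`) is at most `⌊log₂ m⌋ / k⁴`. -/
theorem omega_budget_le {m n k wn : ℕ} (hm : 2 ≤ m) (hn : n ≤ m ^ 4) (hw : 8 * k ^ 4 ≤ wn)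
    (hk : 1 ≤ k) : Nat.log 2 n / wn ≤ Nat.log 2 m / k ^ 4 := by
  have hk4 : 0 < k ^ 4 := by positivity
  have hwn : 0 < wn := by omega
  have hL1 : 1 ≤ Nat.log 2 m := Nat.le_log_of_pow_le one_lt_two (by simpa using hm)
  have hlogn : Nat.log 2 n ≤ 4 * Nat.log 2 m + 3 :=
    (Nat.log_mono_right hn).trans (omega_log_pow_four_le m)
  set b := Nat.log 2 n / wn with hb
  have h1 : b * wn ≤ Nat.log 2 n := Nat.div_mul_le_self _ _
  have h2 : b * (8 * k ^ 4) ≤ b * wn := Nat.mul_le_mul_left _ hw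
  have h3 : 8 * (b * k ^ 4) ≤ 4 * Nat.log 2 m + 3 := by
    have : 8 * (b * k ^ 4) = b * (8 * k ^ 4) := by ring
    omega
  have h4 : b * k ^ 4 ≤ Nat.log 2 m := by omega
  exact (Nat.le_div_iff_mul_le hk4).2 h4

/-- The size comparison: for `2 ≤ m ≤ n ≤ m⁴`, `n^c + 2 ≤ m^{4c+4} ≤ m^{(16c+17)/4}` (as reals). -/
theorem omega_pow_bound {m n c : ℕ} (hm : 2 ≤ m) (hmn : m ≤ n) (hn : n ≤ m ^ 4) :
    ((n ^ c + 2 : ℕ) : ℝ) ≤ (m : ℝ) ^ (((16 * c + 17 : ℕ) : ℝ) / 4) := by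
  -- in `ℕ`: `n^c + 2 ≤ 16 n^c ≤ (m^4)^c * m^4 = m^(4c+4)`
  have hn1 : 1 ≤ n ^ c := Nat.one_le_pow _ _ (by omega)
  have h16 : 16 ≤ m ^ 4 := by
    calc 16 = 2 ^ 4 := by norm_num
      _ ≤ m ^ 4 := Nat.pow_le_pow_left hm 4
  have hnat : n ^ c + 2 ≤ m ^ (4 * c + 4) := by
    calc n ^ c + 2 ≤ n ^ c * 16 := by omega
      _ ≤ (m ^ 4) ^ c * m ^ 4 := Nat.mul_le_mul (Nat.pow_le_pow_left hn c) h16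
      _ = m ^ (4 * c + 4) := by rw [← pow_mul, ← pow_add, mul_comm]
  have hm1 : (1 : ℝ) ≤ m := by exact_mod_cast (show 1 ≤ m by omega)
  have hexp : (((4 * c + 4 : ℕ) : ℝ)) ≤ ((16 * c + 17 : ℕ) : ℝ) / 4 := by
    push_cast
    linarith
  calc ((n ^ c + 2 : ℕ) : ℝ) ≤ ((m ^ (4 * c + 4) : ℕ) : ℝ) := by exact_mod_cast hnat
    _ = (m : ℝ) ^ (((4 * c + 4 : ℕ) : ℝ)) := by rw [Real.rpow_natCast]; push_cast; ring
    _ ≤ (m : ℝ) ^ (((16 * c + 17 : ℕ) : ℝ) / 4) := Real.rpow_le_rpow_of_exponent_le hm1 hexp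

/-! ### The stub -/

/-- **Stub 6 of line `density-ladder` PROVED** (`stub_omegaAssembly`, by name):
`NeglimitedCliqueFixedK → RecurringCliqueSlicesNP → NeglimitedLogOverOmegaNegations`. -/
theorem stub_omegaAssembly :
    NeglimitedCliqueFixedK → RecurringCliqueSlicesNP → NeglimitedLogOverOmegaNegations := by
  rintro hA ⟨L, hNP, hrec⟩
  refine ⟨L, hNP, fun w hw c => ?_⟩
  set k : ℕ := 16 * c + 17 with hkdef
  have hk : 5 ≤ k := by omega
  -- O1: the fixed-`k` engine beyond `m₁`
  obtain ⟨m₁, hm₁⟩ := eventually_atTop.1 (hA k hk)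
  -- O2: `w ≥ 8k⁴` beyond `N`
  obtain ⟨N, hN⟩ := eventually_atTop.1 (tendsto_atTop.1 hw (8 * k ^ 4))
  -- O3: a recurrence of `CLIQUE(m, k)` beyond everything
  rw [frequently_atTop]
  intro n₀
  obtain ⟨m, hm, n, hmn, hnm4, hmono, htransfer⟩ := hrec k hk (max (max m₁ N) (max n₀ 2))
  have hmm₁ : m₁ ≤ m := le_trans (le_trans (le_max_left _ _) (le_max_left _ _)) hm
  have hmN : N ≤ m := le_trans (le_trans (le_max_right _ _) (le_max_left _ _)) hm
  have hmn₀ : n₀ ≤ m := le_trans (le_trans (le_max_left _ _) (le_max_right _ _)) hm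
  have hm2 : 2 ≤ m := le_trans (le_trans (le_max_right _ _) (le_max_right _ _)) hm
  refine ⟨n, hmn₀.trans hmn, hmono, ?_⟩
  -- O4: the budget
  have hbudget : Nat.log 2 n / w n ≤ Nat.log 2 m / k ^ 4 :=
    omega_budget_le hm2 hnm4 (hN n (hmN.trans hmn)) (by omega)
  -- O5: every admissible circuit for `CLIQUE(m, k)` is large
  have hbig : ∀ D : Circuit ↥(⊤ : SimpleGraph (Fin m)).edgeSet, D.IsOver deMorganBasis →
      D.Computes (cliqueFn m k) → D.negationCount ≤ Nat.log 2 n / w n → n ^ c + 1 ≤ D.size := by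
    intro D hD hcomp hneg
    have h1 := hm₁ m hmm₁ D hD hcomp (hneg.trans hbudget)
    have h2 := omega_pow_bound (c := c) hm2 hmn hnm4
    have h3 : ((n ^ c + 2 : ℕ) : ℝ) < (D.size : ℝ) + 1 := h2.trans_lt h1
    have h4 : n ^ c + 2 < D.size + 1 := by exact_mod_cast h3
    omega
  -- O6
  have h := htransfer (Nat.log 2 n / w n) (n ^ c + 1) hbig
  omega

/-- **THE RUNG `NeglimitedLogOverOmegaNegations` (R9-B) PROVED** against the verbatim local copy of the item
signature (stmt-PneNP-19555): the registered composition of line `density-ladder` applied to the landed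
engine `neglimitedCliqueFixedK_holds` (R9-A, itself `stub_fixedKAssembly stub_largeNPow stub_ladderAdvantage
stub_subcriticalNullMass`) and the landed slice plumbing `stub_recurringCliqueSlicesNP`. -/
theorem neglimitedLogOverOmegaNegations_holds : NeglimitedLogOverOmegaNegations :=
  stub_omegaAssembly neglimitedCliqueFixedK_holds stub_recurringCliqueSlicesNP

end Summit.PneNP.PneNP.Theorems.NegLimitedLadder
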